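import Summits.NavierStokesRegularity.NavierStokesRegularity.Theorems.TerminalTraceTypeITraceScarL3ApexZoomLimit
import Summits.NavierStokesRegularity.NavierStokesRegularity.Theorems.TerminalTraceTypeITraceScarL3ApexPackageTimeShift
import Summits.NavierStokesRegularity.NavierStokesRegularity.Theorems.TerminalTraceTypeITraceScarL3SeqCompactnessLevels
import Summits.NavierStokesRegularity.NavierStokesRegularity.Theorems.TerminalTraceTypeITraceScarL3SeqCompactness
import Summits.NavierStokesRegularity.NavierStokesRegularity.Theorems.TerminalTraceTypeITraceScarL3SeqLimitLsc
import Summits.NavierStokesRegularity.NavierStokesRegularity.Theorems.TerminalTraceTypeITraceScarL3SeqLimitTop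
import Summits.NavierStokesRegularity.NavierStokesRegularity.Theorems.TerminalTraceTypeITraceScarL3CaseOneNontrivial
import HarnessLib

/-!
# The limit of the Case-1 zoom family (tool for stub Z4 `stub_caseOneZoom` of the line `radius_dichotomy`,
# item `TerminalTrace.TypeITraceScarL3`, stmt-NavierStokesRegularity-18385)

Seat nsreg-C26-p1 g5 (cell ns-regularity-ideate), `--supports stmt-NavierStokesRegularity-18385`.

`caseOne_limit`: a sequence `(F_k, P_k, G_k)` of extinct Type-I apices of one class `(M, D₀, C)` which is a.e.
bounded by `4` on `]−1/16, 0[ × B(0, k + 4)` and never a.e. bounded by `1/2` on `Q_2(0)` (the output of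
`caseOne_family`) has, along a subsequence, a limit `(w, ϖ, H)`: suitable in every `Q_a(0)` and on the half-space,
`𝐈 ≤ 4M`, `D ≤ D₀` at all apices, the rate a.e., weakly vanishing at the top time, a.e. bounded by `4` on the late
whole-space slab `]−1/16, 0[ × ℝ³`, and NOT a.e. zero on `Q_3(0)`.  Assembly of `exists_seqLevels`, `glue_seqLevels`,
`slab_typeIBound_of_seqLimit`, `cknD_le_of_seqLimit`, `weakNull_of_seqLimit`, `not_ae_zero_of_seqLimit_of_not_bounded`,
`ae_le_of_tendsto_eLpNorm_three`.
WHAT THIS IS NOT: 18385 / NS regularity NOT proved. [cite: Seregin2014, §6.6 Prop. 6.20] [cite: EscauriazaSereginSverak2003, §3]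
-/

noncomputable section

set_option linter.dupNamespace false

namespace Summit.NavierStokesRegularity.NavierStokesRegularity.Theorems.TypeITraceScarL3

open MeasureTheory Set Function Filter Topology TopologicalSpace Metric InnerProductSpace
open Literature.Analysis.FluidPDE
open scoped NNReal ENNReal RealInnerProductSpace

set_option maxHeartbeats 3200000 in
/-- **The subsequential limit of the Case-1 zoom family and its properties** (see the module docstring).
[cite: Seregin2014, §6.6 Prop. 6.20] [cite: EscauriazaSereginSverak2003, §3] -/
theorem caseOne_limit
    {F : ℕ → ℝ → EuclideanSpace ℝ (Fin 3) → EuclideanSpace ℝ (Fin 3)}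
    {Pk : ℕ → ℝ → EuclideanSpace ℝ (Fin 3) → ℝ}
    {Gk : ℕ → ℝ → EuclideanSpace ℝ (Fin 3) → EuclideanSpace ℝ (Fin 3) →L[ℝ] EuclideanSpace ℝ (Fin 3)}
    {M D₀ : ℝ≥0} {C : ℝ} (hC : 0 ≤ C)
    (hFsw : ∀ k (a : ℝ), 0 < a →
      IsSuitableWeakSolutionInBall a (0 : ℝ × EuclideanSpace ℝ (Fin 3)) (F k) (Pk k))
    (hFG : ∀ k (a : ℝ), 0 < a →
      HasWeakSpatialGradientOn
        (parabolicCylinderOpens a (0 : ℝ × EuclideanSpace ℝ (Fin 3))) (F k) (Gk k))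
    (hFI : ∀ k (a : ℝ), 0 < a →
      typeIBound (parabolicCylinder a (0 : ℝ × EuclideanSpace ℝ (Fin 3))) (F k) (Pk k) (Gk k) ≤ M)
    (hFD : ∀ k (z₀ : ℝ × EuclideanSpace ℝ (Fin 3)), z₀.1 ≤ 0 →
      ∀ r : ℝ, 0 < r → cknD r z₀ (Pk k) ≤ D₀)
    (hFrate : ∀ k (s : ℝ), s < 0 →
      ∀ᵐ y : EuclideanSpace ℝ (Fin 3), ‖F k s y‖ ≤ C / Real.sqrt (-s))
    (hFtop : ∀ k, ∀ φ : EuclideanSpace ℝ (Fin 3) → EuclideanSpace ℝ (Fin 3),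
      ContDiff ℝ (⊤ : ℕ∞) φ →
      HasCompactSupport φ → ∀ ε : ℝ, 0 < ε →
      ∃ s₀ : ℝ, s₀ < 0 ∧ ∀ᵐ s ∂(volume.restrict (Ioo s₀ 0)), |∫ y, ⟪F k s y, φ y⟫| ≤ ε)
    (hlate : ∀ k, ∀ᵐ z ∂(volume.restrict (Ioo (-(1 / 16 : ℝ)) 0 ×ˢ
        ball (0 : EuclideanSpace ℝ (Fin 3)) ((k : ℝ) + 4))), ‖F k z.1 z.2‖ ≤ 4)
    (hnot : ∀ k, ¬ (∀ᵐ z ∂(volume.restrict (parabolicCylinder 2 (0 : ℝ × EuclideanSpace ℝ (Fin 3)))),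
        ‖F k z.1 z.2‖ ≤ 2⁻¹)) :
    ∃ (w : ℝ → EuclideanSpace ℝ (Fin 3) → EuclideanSpace ℝ (Fin 3)) (ϖ : ℝ → EuclideanSpace ℝ (Fin 3) → ℝ)
      (H : ℝ → EuclideanSpace ℝ (Fin 3) → EuclideanSpace ℝ (Fin 3) →L[ℝ] EuclideanSpace ℝ (Fin 3)),
      (∀ a : ℝ, 0 < a → IsSuitableWeakSolutionInBall a (0 : ℝ × EuclideanSpace ℝ (Fin 3)) w ϖ) ∧
      HasWeakSpatialGradientOn (slab (EuclideanSpace ℝ (Fin 3)) (Iio 0) isOpen_Iio) w H ∧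
      typeIBound (Iio (0 : ℝ) ×ˢ univ) w ϖ H ≤ 4 * (M : ℝ≥0∞) ∧
      (∀ z₀ : ℝ × EuclideanSpace ℝ (Fin 3), z₀.1 ≤ 0 → ∀ r : ℝ, 0 < r → cknD r z₀ ϖ ≤ D₀) ∧
      (∀ᵐ z ∂(volume.restrict (Iio (0 : ℝ) ×ˢ (univ : Set (EuclideanSpace ℝ (Fin 3))))),
        ‖w z.1 z.2‖ ≤ C / Real.sqrt (-z.1)) ∧
      (∀ φ : EuclideanSpace ℝ (Fin 3) → EuclideanSpace ℝ (Fin 3), ContDiff ℝ (⊤ : ℕ∞) φ →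
        HasCompactSupport φ → ∀ ε : ℝ, 0 < ε →
        ∃ s₀ : ℝ, s₀ < 0 ∧ ∀ᵐ s ∂(volume.restrict (Ioo s₀ 0)), |∫ y, ⟪w s y, φ y⟫| ≤ ε) ∧
      (∀ᵐ z ∂(volume.restrict (Ioo (-(1 / 16 : ℝ)) 0 ×ˢ (univ : Set (EuclideanSpace ℝ (Fin 3))))),
        ‖w z.1 z.2‖ ≤ 4) ∧
      ¬ (∀ᵐ z ∂(volume.restrict (parabolicCylinder 3 (0 : ℝ × EuclideanSpace ℝ (Fin 3)))), w z.1 z.2 = 0) := by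
  -- ## measurability, `C`, `A`, `D` bounds and `L³` membership of the family
  have hFm : ∀ k (a : ℝ), 0 < a → AEStronglyMeasurable (uncurry (F k))
      (volume.restrict (parabolicCylinder a (0 : ℝ × EuclideanSpace ℝ (Fin 3)))) := by
    intro k a ha
    have h := (hFsw k a ha).1.distributional.1.aestronglyMeasurable
    rw [coe_parabolicCylinderOpens] at h
    exact h
  have hPm : ∀ k (a : ℝ), 0 < a → AEStronglyMeasurable (uncurry (Pk k))
      (volume.restrict (parabolicCylinder a (0 : ℝ × EuclideanSpace ℝ (Fin 3)))) :=
    fun k a ha => (hFsw k a ha).2.2.2.aestronglyMeasurable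
  have hFC : ∀ k (a : ℝ), 0 < a → cknC a (0 : ℝ × EuclideanSpace ℝ (Fin 3)) (F k) ≤ M := fun k a ha =>
    (cknC_le_abScaledSum (p := Pk k) (G := Gk k)).trans
      ((abScaledSum_le_typeIBound ha subset_rfl).trans (hFI k a ha))
  have hFA : ∀ k (a : ℝ), 0 < a → cknAEss a (0 : ℝ × EuclideanSpace ℝ (Fin 3)) (F k) ≤ M := fun k a ha =>
    (cknAEss_le_abScaledSum (p := Pk k) (G := Gk k)).trans
      ((abScaledSum_le_typeIBound ha subset_rfl).trans (hFI k a ha))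
  have hFD0 : ∀ k (a : ℝ), 0 < a → cknD a (0 : ℝ × EuclideanSpace ℝ (Fin 3)) (Pk k) ≤ D₀ :=
    fun k a ha => hFD k 0 le_rfl a ha
  have hF3 : ∀ a : ℝ, 0 < a → ∀ k, MemLp (uncurry (F k)) 3
      (volume.restrict (parabolicCylinder a (0 : ℝ × EuclideanSpace ℝ (Fin 3)))) := by
    intro a ha k
    refine ⟨hFm k a ha, ?_⟩
    have hC' := hFC k a ha
    unfold cknC at hC'
    have ha2 : (ENNReal.ofReal a ^ 2)⁻¹ ≠ 0 := ENNReal.inv_ne_zero.2 (ENNReal.pow_ne_top ENNReal.ofReal_ne_top)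
    have hfin : ∫⁻ w' in parabolicCylinder a (0 : ℝ × EuclideanSpace ℝ (Fin 3)),
        ‖(F k) w'.1 w'.2‖ₑ ^ (3 : ℕ) < ⊤ := by
      have h1 : (ENNReal.ofReal a ^ 2)⁻¹ * ∫⁻ w' in parabolicCylinder a (0 : ℝ × EuclideanSpace ℝ (Fin 3)),
          ‖(F k) w'.1 w'.2‖ₑ ^ (3 : ℕ) < ⊤ := lt_of_le_of_lt hC' ENNReal.coe_lt_top
      by_contra htop'
      rw [not_lt, top_le_iff] at htop'
      rw [htop', ENNReal.mul_top ha2] at h1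
      exact lt_irrefl _ h1
    rw [eLpNorm_eq_lintegral_rpow_enorm_toReal (by norm_num) (by norm_num), ENNReal.toReal_ofNat]
    refine ENNReal.rpow_lt_top_of_nonneg (by norm_num) (ne_of_lt (lt_of_le_of_lt (le_of_eq ?_) hfin))
    refine lintegral_congr fun q => ?_
    show ‖F k q.1 q.2‖ₑ ^ (3 : ℝ) = ‖F k q.1 q.2‖ₑ ^ (3 : ℕ)
    rw [← ENNReal.rpow_natCast]
    norm_num
  -- ## extraction
  obtain ⟨δ, hδ, hδge, hlev⟩ := exists_seqLevels hFsw hFC hFD0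
  choose wl πl hwl using hlev
  obtain ⟨w, ϖ, hlim⟩ := glue_seqLevels (V := fun j => F (δ j)) (Pj := fun j => Pk (δ j))
    (fun j a ha => hFm (δ j) a ha) (wl := wl) (πl := πl) hwl
  -- ## the class of the limit
  obtain ⟨-, H, hH, h4I⟩ := slab_typeIBound_of_seqLimit (M : ℝ≥0∞) ENNReal.coe_lt_top
    (v := fun j => F (δ j)) (π := fun j => Pk (δ j)) (G := fun j => Gk (δ j))
    (fun j a ha => hFsw (δ j) a ha) (fun j a ha => hFG (δ j) a ha) (fun j a ha => hFI (δ j) a ha) hlim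
  have hDlim : ∀ z₀ : ℝ × EuclideanSpace ℝ (Fin 3), z₀.1 ≤ 0 → ∀ r : ℝ, 0 < r → cknD r z₀ ϖ ≤ D₀ :=
    fun z₀ hz₀ r hr => cknD_le_of_seqLimit (π := fun j => Pk (δ j)) (fun j a ha => hPm (δ j) a ha)
      (fun j z hz r' hr' => hFD (δ j) z hz r' hr') (fun a ha => (hlim a ha).1.2.2.2)
      (fun a ha => (hlim a ha).2.2.2) hz₀ hr
  -- the rate, a.e. on the slab
  have hae_rate : ∀ᵐ z ∂(volume.restrict (Iio (0 : ℝ) ×ˢ (univ : Set (EuclideanSpace ℝ (Fin 3))))),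
      ‖w z.1 z.2‖ ≤ C / Real.sqrt (-z.1) := by
    have hcover : Iio (0 : ℝ) ×ˢ (univ : Set (EuclideanSpace ℝ (Fin 3))) ⊆
        ⋃ n : ℕ, parabolicCylinder ((n : ℝ) + 1) (0 : ℝ × EuclideanSpace ℝ (Fin 3)) := by
      rintro ⟨s, y⟩ ⟨hs, -⟩
      obtain ⟨n, hn⟩ := exists_nat_ge (max (-s) ‖y‖)
      have h1 : -s ≤ n := (le_max_left _ _).trans hn
      have h2 : ‖y‖ ≤ n := (le_max_right _ _).trans hn
      have hs' : s < 0 := hs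
      refine mem_iUnion.2 ⟨n, ?_⟩
      rw [SuitableCompactness.mem_parabolicCylinder_zero]
      refine ⟨⟨?_, hs'⟩, by simp only; linarith⟩
      have h3 : (n : ℝ) + 1 ≤ ((n : ℝ) + 1) ^ 2 := by nlinarith [n.cast_nonneg (α := ℝ)]
      linarith
    refine ae_restrict_of_ae_restrict_of_subset hcover ?_
    rw [ae_restrict_iUnion_iff]
    intro n
    have hn : (0 : ℝ) < (n : ℝ) + 1 := by positivity
    refine ae_le_of_tendsto_eLpNorm_three (fun j => hFm (δ j) _ hn) (hlim _ hn).2.1.aestronglyMeasurable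
      (hlim _ hn).2.2.1 (Eventually.of_forall fun j => ?_)
    exact ae_cylinder_rate_of_slices (hFm (δ j) _ hn) (hFrate (δ j))
  -- weak vanishing at the top
  have htop_w := weakNull_of_seqLimit (F := fun j => F (δ j)) (P := fun j => Pk (δ j)) (K := max M D₀)
    (fun j a ha => hFsw (δ j) a ha)
    (fun j a ha => (hFA (δ j) a ha).trans (by exact_mod_cast le_max_left M D₀))
    (fun j a ha => (hFD0 (δ j) a ha).trans (by exact_mod_cast le_max_right M D₀))
    (fun j => hFtop (δ j)) (fun a ha j => hF3 a ha (δ j)) (fun a ha => (hlim a ha).2.1)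
    (fun a ha => (hlim a ha).2.2.1)
  -- ## the late bound `4`, ball by ball
  have hlate_w : ∀ᵐ z ∂(volume.restrict (Ioo (-(1 / 16 : ℝ)) 0 ×ˢ (univ : Set (EuclideanSpace ℝ (Fin 3))))),
      ‖w z.1 z.2‖ ≤ 4 := by
    have hcover : Ioo (-(1 / 16 : ℝ)) 0 ×ˢ (univ : Set (EuclideanSpace ℝ (Fin 3))) ⊆
        ⋃ n : ℕ, Ioo (-(1 / 16 : ℝ)) 0 ×ˢ ball (0 : EuclideanSpace ℝ (Fin 3)) ((n : ℝ) + 1) := by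
      rintro ⟨s, y⟩ ⟨hs, -⟩
      obtain ⟨n, hn⟩ := exists_nat_gt ‖y‖
      refine mem_iUnion.2 ⟨n, hs, ?_⟩
      rw [mem_ball, dist_zero_right]
      linarith
    refine ae_restrict_of_ae_restrict_of_subset hcover ?_
    rw [ae_restrict_iUnion_iff]
    intro n
    set Sn : Set (ℝ × EuclideanSpace ℝ (Fin 3)) :=
      Ioo (-(1 / 16 : ℝ)) 0 ×ˢ ball (0 : EuclideanSpace ℝ (Fin 3)) ((n : ℝ) + 1) with hSn
    have ha : (0 : ℝ) < (n : ℝ) + 1 := by positivity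
    have hsub : Sn ⊆ parabolicCylinder ((n : ℝ) + 1) (0 : ℝ × EuclideanSpace ℝ (Fin 3)) := by
      rintro ⟨s, y⟩ ⟨hs, hy⟩
      rw [SuitableCompactness.mem_parabolicCylinder_zero]
      have h3 : (1 / 16 : ℝ) ≤ ((n : ℝ) + 1) ^ 2 := by nlinarith [n.cast_nonneg (α := ℝ)]
      refine ⟨⟨by linarith [hs.1], hs.2⟩, ?_⟩
      simpa using hy
    have hle : volume.restrict Sn ≤
        volume.restrict (parabolicCylinder ((n : ℝ) + 1) (0 : ℝ × EuclideanSpace ℝ (Fin 3))) :=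
      Measure.restrict_mono hsub le_rfl
    -- for `j ≥ n`, `B(0, n + 1) ⊆ B(0, δ j + 4)`
    have hev : ∀ᶠ j in atTop, ∀ᵐ z ∂(volume.restrict Sn), ‖F (δ j) z.1 z.2‖ ≤ 4 := by
      filter_upwards [eventually_ge_atTop n] with j hj
      have hsub' : Sn ⊆ Ioo (-(1 / 16 : ℝ)) 0 ×ˢ ball (0 : EuclideanSpace ℝ (Fin 3)) ((δ j : ℝ) + 4) := by
        refine prod_mono Subset.rfl (ball_subset_ball ?_)
        have h1 : (n : ℝ) ≤ (δ j : ℝ) := by exact_mod_cast hj.trans (hδge j)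
        linarith
      exact ae_restrict_of_ae_restrict_of_subset hsub' (hlate (δ j))
    exact ae_le_of_tendsto_eLpNorm_three (μ := volume.restrict Sn) (F := fun j => uncurry (F (δ j)))
      (V := uncurry w) (b := fun _ => 4) (fun j => (hFm (δ j) _ ha).mono_measure hle)
      ((hlim _ ha).2.1.aestronglyMeasurable.mono_measure hle)
      (tendsto_of_tendsto_of_tendsto_of_le_of_le tendsto_const_nhds (hlim _ ha).2.2.1 (fun j => bot_le)
        fun j => eLpNorm_mono_measure _ hle) hev
  -- ## non-triviality
  have hQ3 : (0 : ℝ) < 3 := by norm_num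
  have hL : ∀ j, ∀ᵐ z ∂(volume.restrict (parabolicCylinder 3 (0 : ℝ × EuclideanSpace ℝ (Fin 3)))),
      ‖F (δ j) z.1 z.2‖ ≤ max 4 (C / Real.sqrt (1 / 32)) := by
    intro j
    have hcover : parabolicCylinder 3 (0 : ℝ × EuclideanSpace ℝ (Fin 3)) ⊆
        (Ioo (-(9 : ℝ)) (-(1 / 32)) ×ˢ (univ : Set (EuclideanSpace ℝ (Fin 3)))) ∪
          (Ioo (-(1 / 16 : ℝ)) 0 ×ˢ ball (0 : EuclideanSpace ℝ (Fin 3)) ((δ j : ℝ) + 4)) := by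
      rintro ⟨s, y⟩ hz
      rw [SuitableCompactness.mem_parabolicCylinder_zero] at hz
      obtain ⟨⟨hs1, hs2⟩, hy⟩ := hz
      by_cases hs : s < -(1 / 32)
      · exact Or.inl ⟨⟨by linarith, hs⟩, mem_univ _⟩
      · refine Or.inr ⟨⟨by linarith, hs2⟩, ?_⟩
        rw [mem_ball, dist_zero_right]
        have : (0 : ℝ) ≤ (δ j : ℝ) := Nat.cast_nonneg _
        simp only at hy
        linarith
    refine ae_restrict_of_ae_restrict_of_subset hcover ?_
    rw [ae_restrict_union_iff]
    constructor
    · have h := ae_prod_norm_le_of_rate (hFsw (δ j)) (hFrate (δ j)) hC (b := 1 / 32) (T := 9)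
        (by norm_num) (by norm_num)
      filter_upwards [h] with z hz
      exact hz.trans (le_max_right _ _)
    · filter_upwards [hlate (δ j)] with z hz
      exact hz.trans (le_max_left _ _)
  have hP : ∀ j, ∫⁻ z in parabolicCylinder 3 (0 : ℝ × EuclideanSpace ℝ (Fin 3)),
      ‖Pk (δ j) z.1 z.2‖ₑ ^ (3 / 2 : ℝ) ≤ ((9 * D₀ : ℝ≥0) : ℝ≥0∞) := by
    intro j
    have h1 := hFD0 (δ j) 3 hQ3
    rw [cknD] at h1
    have h32 : (ENNReal.ofReal 3 ^ 2) ≠ 0 := pow_ne_zero _ ((ENNReal.ofReal_pos.2 hQ3).ne')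
    have h32' : (ENNReal.ofReal 3 ^ 2) ≠ ∞ := ENNReal.pow_ne_top ENNReal.ofReal_ne_top
    have h2 := (ENNReal.inv_mul_le_iff h32 h32').1 h1
    refine h2.trans (le_of_eq ?_)
    rw [ENNReal.ofReal_ofNat, ENNReal.coe_mul]
    norm_num
  have hne : ¬ (∀ᵐ z ∂(volume.restrict (parabolicCylinder 3 (0 : ℝ × EuclideanSpace ℝ (Fin 3)))),
      w z.1 z.2 = 0) :=
    not_ae_zero_of_seqLimit_of_not_bounded (F := fun j => F (δ j)) (P := fun j => Pk (δ j))
      (fun j => hFsw (δ j) 3 hQ3) hL hP (fun j => hnot (δ j)) (hlim 3 hQ3).2.2.1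
  exact ⟨w, ϖ, H, fun a ha => (hlim a ha).1, hH, h4I, hDlim, hae_rate, htop_w, hlate_w, hne⟩

end Summit.NavierStokesRegularity.NavierStokesRegularity.Theorems.TypeITraceScarL3

end
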